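import Summits.CriticalPhenomena.PercolationContinuityZ3.Theorems.PercNearOneGluingNoHeavyLowerTailCubicThreePointHubEdgeHa
import Summits.CriticalPhenomena.PercolationContinuityZ3.Theorems.PercNearOneGluingNoHeavyLowerTailCubicThreePointHubEdgeHb
import Mathlib.Tactic.Linarith
import HarnessLib

/-!
# `NoHeavyLowerTail` (stmt-CriticalPhenomena-4575) — the sharp cubic row BEYOND series–parallel: the HUB-EDGE THEOREM (assembly)

Support file (prover prim-gen-kcluster gen 10, k-cluster line; `--supports stmt-CriticalPhenomena-4575`).  Pure polynomial algebra over `ℝ`: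
no measure theory, no definitions, no named facts, no sorries.  Cell convention `(q,u₁,u₂,u₃,t) = (P(a|b|c),P(ab|c),P(ac|b),P(bc|a),P(abc))`
and forms `AG = qt − e₂(u)`, `Ha = t·AG − e₃`, `Hb = q·AG − e₃` of `…CubicThreePointTerminalClosure`; sharp row `Hmax3 = max(Ha,Hb) ≥ 0`
(`…CubicThreePointSharpDichotomy`: `⟺ P(abc)² ≥ P(ab)P(ac)P(bc) ∨ P(a|b|c)² ≥ ∏ P(i ∤ rest)`; proved on all series–parallel laws by
`SPLaw.sharp`, `…CubicThreePointSeriesParallel`).  `H₂ = K_{2,3} +` hub edge is the smallest three-terminal graph that is not series–parallel: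
two hubs with independent arms `a, b, c` resp. `A, B, C` to the terminals and a hub–hub edge of probability `p`; conditioning on that edge its law
is the segment `L_p = (1−p)·w + p·z`, `w = x ⊙ y` (the two star laws in parallel, `K_{2,3}`), `z =` the MERGED star (arms `a + A − aA`, …).

**THEOREM (`hubEdge_sharp`).** For all arms and `p` in `[0,1]`: `AG(L_p) ≥ 0` and `max(Ha, Hb)(L_p) ≥ 0` — i.e. the dichotomy
`P(abc)² ≥ P(ab)P(ac)P(bc) ∨ P(a|b|c)² ≥ ∏ᵢ P(i ∤ rest)` holds on the smallest non-series–parallel three-terminal graph for all weights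
(dense side `hubEdge_Ha_nonneg`, sparse side `hubEdge_Hb_nonneg`, `AG` by `hubEdge_AG_nonneg`; all from exact LP certificates in the free ring
`ℤ[x, x']`, files `…HubEdge{C0,C1,C2,D0,D1,D2,D3,AG}`).  The cells of `L_p` are probabilities (`hubEdge_cells`), so `L_p` can be fed to the
K3-semigroup theorem `maxH_join_nonneg` / `maxH_meet_nonneg`.

CONSEQUENCE (paper-level; the graph ↔ law dictionary is not formalized here).  Conditioning on the percolation cluster partition of the Steiner
part `G° = G − {a,b,c}` of a weighted graph, the terminals attach to the blocks independently, so `law(G) = [⊙ chords] ⊙ E[⊙_blocks merged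
star]` and Steiner components factor under `⊙`.  Hence, with `SPLaw.sharp`: **the sharp row `Hmax3 ≥ 0` — and with it `H_{q+t}`, `AG⁺`,
`SHK3⁺` — holds for every weighted graph whose Steiner part has connected components of size `≤ 2`** (in particular every three-terminal
graph on `≤ 5` vertices), the first class beyond series–parallel.  The one-coordinate induction, by contrast, is dead even with the exact region
as hypothesis (memo run/shared/lean/prim/prim-gen-kcluster/KCLUSTER-gen10.md §1–§3).
[cite: Gladkov2024StrongFKG, Cor. 4.2 (AG)]; [cite: GrimmettManolescuAOP2013, star–triangle transformation (the ridge `t = q`)]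
-/

namespace Summit.CriticalPhenomena.PercolationContinuityZ3.Theorems

namespace CubicThreePointHub

open CubicThreePointTerminal

/-- For `x, y ∈ [0,1]`: `0 ≤ x + y − xy ≤ 1` (merged arm). [folklore] -/
theorem mergedArm_mem {x y : ℝ} (hx : 0 ≤ x) (hx1 : x ≤ 1) (hy : 0 ≤ y) (hy1 : y ≤ 1) :
    0 ≤ x + y - x * y ∧ x + y - x * y ≤ 1 := by
  constructor
  · have e : x + y - x * y = x + y * (1 - x) := by ring
    rw [e]; exact add_nonneg hx (mul_nonneg hy (sub_nonneg.mpr hx1))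
  · have e : 1 - (x + y - x * y) = (1 - x) * (1 - y) := by ring
    have h : 0 ≤ (1 - x) * (1 - y) := mul_nonneg (sub_nonneg.mpr hx1) (sub_nonneg.mpr hy1)
    linarith

/-- For arms in `[0,1]`: the star cell `P(a|b|c) = 1 − (αβ+αγ+βγ) + 2αβγ ≥ 0`. [folklore] -/
theorem starQ_nonneg {x y z : ℝ} (hx : 0 ≤ x) (hx1 : x ≤ 1) (hy : 0 ≤ y) (hy1 : y ≤ 1) (hz : 0 ≤ z) (hz1 : z ≤ 1) :
    0 ≤ 1 - (x * y + x * z + y * z) + 2 * (x * y * z) := by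
  have e : 1 - (x * y + x * z + y * z) + 2 * (x * y * z)
      = (1 - x) * (1 - y) * (1 - z) + x * (1 - y) * (1 - z) + (1 - x) * y * (1 - z) + (1 - x) * (1 - y) * z := by ring
  rw [e]
  have hx' := sub_nonneg.mpr hx1; have hy' := sub_nonneg.mpr hy1; have hz' := sub_nonneg.mpr hz1
  have t1 := mul_nonneg (mul_nonneg hx' hy') hz'; have t2 := mul_nonneg (mul_nonneg hx hy') hz'
  have t3 := mul_nonneg (mul_nonneg hx' hy) hz'; have t4 := mul_nonneg (mul_nonneg hx' hy') hz
  linarith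

set_option maxHeartbeats 4000000 in
/-- The cells of the hub-edge law `L_p` are nonnegative and sum to `1`. [folklore] -/
theorem hubEdge_cells {p a b c A B C qw w₁ w₂ w₃ tw qz z₁ z₂ z₃ tz q u₁ u₂ u₃ t : ℝ}
    (hp₀ : 0 ≤ p) (hp₁ : p ≤ 1) (ha₀ : 0 ≤ a) (ha₁ : a ≤ 1) (hb₀ : 0 ≤ b) (hb₁ : b ≤ 1) (hc₀ : 0 ≤ c) (hc₁ : c ≤ 1)
    (hA₀ : 0 ≤ A) (hA₁ : A ≤ 1) (hB₀ : 0 ≤ B) (hB₁ : B ≤ 1) (hC₀ : 0 ≤ C) (hC₁ : C ≤ 1)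
    (hqw : qw = (1 - (a * b + a * c + b * c) + 2 * (a * b * c)) * (1 - (A * B + A * C + B * C) + 2 * (A * B * C)))
    (hw₁ : w₁ = (1 - (a * b + a * c + b * c) + 2 * (a * b * c)) * (A * B * (1 - C)) + a * b * (1 - c) * (1 - (A * B + A * C + B * C) + 2 * (A * B * C))
        + a * b * (1 - c) * (A * B * (1 - C)))
    (hw₂ : w₂ = (1 - (a * b + a * c + b * c) + 2 * (a * b * c)) * (A * C * (1 - B)) + a * c * (1 - b) * (1 - (A * B + A * C + B * C) + 2 * (A * B * C))
        + a * c * (1 - b) * (A * C * (1 - B)))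
    (hw₃ : w₃ = (1 - (a * b + a * c + b * c) + 2 * (a * b * c)) * (B * C * (1 - A)) + b * c * (1 - a) * (1 - (A * B + A * C + B * C) + 2 * (A * B * C))
        + b * c * (1 - a) * (B * C * (1 - A)))
    (htw : tw = a * b * c * ((1 - (A * B + A * C + B * C) + 2 * (A * B * C)) + A * B * (1 - C) + A * C * (1 - B) + B * C * (1 - A) + A * B * C)
        + A * B * C * ((1 - (a * b + a * c + b * c) + 2 * (a * b * c)) + a * b * (1 - c) + a * c * (1 - b) + b * c * (1 - a))
       
        + (a * b * (1 - c) * (A * C * (1 - B) + B * C * (1 - A)) + a * c * (1 - b) * (A * B * (1 - C) + B * C * (1 - A))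
        + b * c * (1 - a) * (A * B * (1 - C) + A * C * (1 - B))))
    (hqz : qz = 1 - ((a + A - a * A) * (b + B - b * B) + (a + A - a * A) * (c + C - c * C) + (b + B - b * B) * (c + C - c * C)) + 2 * ((a + A - a * A) * (b
        + B - b * B) * (c + C - c * C)))
    (hz₁ : z₁ = (a + A - a * A) * (b + B - b * B) * (1 - (c + C - c * C)))
    (hz₂ : z₂ = (a + A - a * A) * (c + C - c * C) * (1 - (b + B - b * B)))
    (hz₃ : z₃ = (b + B - b * B) * (c + C - c * C) * (1 - (a + A - a * A)))
    (htz : tz = (a + A - a * A) * (b + B - b * B) * (c + C - c * C))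
    (hq : q = (1 - p) * qw + p * qz) (hu₁ : u₁ = (1 - p) * w₁ + p * z₁) (hu₂ : u₂ = (1 - p) * w₂ + p * z₂)
    (hu₃ : u₃ = (1 - p) * w₃ + p * z₃) (ht : t = (1 - p) * tw + p * tz) :
    0 ≤ q ∧ 0 ≤ u₁ ∧ 0 ≤ u₂ ∧ 0 ≤ u₃ ∧ 0 ≤ t ∧ q + u₁ + u₂ + u₃ + t = 1 := by
  have hp' : 0 ≤ 1 - p := sub_nonneg.mpr hp₁
  have ha' : 0 ≤ 1 - a := sub_nonneg.mpr ha₁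
  have hb' : 0 ≤ 1 - b := sub_nonneg.mpr hb₁
  have hc' : 0 ≤ 1 - c := sub_nonneg.mpr hc₁
  have hA' : 0 ≤ 1 - A := sub_nonneg.mpr hA₁
  have hB' : 0 ≤ 1 - B := sub_nonneg.mpr hB₁
  have hC' : 0 ≤ 1 - C := sub_nonneg.mpr hC₁
  have hxq := starQ_nonneg ha₀ ha₁ hb₀ hb₁ hc₀ hc₁
  have hyq := starQ_nonneg hA₀ hA₁ hB₀ hB₁ hC₀ hC₁
  obtain ⟨hma, hma1⟩ := mergedArm_mem ha₀ ha₁ hA₀ hA₁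
  obtain ⟨hmb, hmb1⟩ := mergedArm_mem hb₀ hb₁ hB₀ hB₁
  obtain ⟨hmc, hmc1⟩ := mergedArm_mem hc₀ hc₁ hC₀ hC₁
  have hzq' := starQ_nonneg hma hma1 hmb hmb1 hmc hmc1
  have hma' : 0 ≤ 1 - (a + A - a * A) := sub_nonneg.mpr hma1
  have hmb' : 0 ≤ 1 - (b + B - b * B) := sub_nonneg.mpr hmb1
  have hmc' : 0 ≤ 1 - (c + C - c * C) := sub_nonneg.mpr hmc1
  have hx1 : 0 ≤ a * b * (1 - c) := mul_nonneg (mul_nonneg ha₀ hb₀) hc'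
  have hx2 : 0 ≤ a * c * (1 - b) := mul_nonneg (mul_nonneg ha₀ hc₀) hb'
  have hx3 : 0 ≤ b * c * (1 - a) := mul_nonneg (mul_nonneg hb₀ hc₀) ha'
  have hxt : 0 ≤ a * b * c := mul_nonneg (mul_nonneg ha₀ hb₀) hc₀
  have hy1 : 0 ≤ A * B * (1 - C) := mul_nonneg (mul_nonneg hA₀ hB₀) hC'
  have hy2 : 0 ≤ A * C * (1 - B) := mul_nonneg (mul_nonneg hA₀ hC₀) hB'
  have hy3 : 0 ≤ B * C * (1 - A) := mul_nonneg (mul_nonneg hB₀ hC₀) hA'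
  have hyt : 0 ≤ A * B * C := mul_nonneg (mul_nonneg hA₀ hB₀) hC₀
  have hQw : 0 ≤ qw := by rw [hqw]; exact mul_nonneg hxq hyq
  have hW1 : 0 ≤ w₁ := by
    rw [hw₁]; exact add_nonneg (add_nonneg (mul_nonneg hxq hy1) (mul_nonneg hx1 hyq)) (mul_nonneg hx1 hy1)
  have hW2 : 0 ≤ w₂ := by
    rw [hw₂]; exact add_nonneg (add_nonneg (mul_nonneg hxq hy2) (mul_nonneg hx2 hyq)) (mul_nonneg hx2 hy2)
  have hW3 : 0 ≤ w₃ := by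
    rw [hw₃]; exact add_nonneg (add_nonneg (mul_nonneg hxq hy3) (mul_nonneg hx3 hyq)) (mul_nonneg hx3 hy3)
  have hTw : 0 ≤ tw := by
    rw [htw]
    have s1 : 0 ≤ 1 - (A * B + A * C + B * C) + 2 * (A * B * C) + A * B * (1 - C) + A * C * (1 - B) + B * C * (1 - A) + A * B * C := by
      linarith
    have s2 : 0 ≤ 1 - (a * b + a * c + b * c) + 2 * (a * b * c) + a * b * (1 - c) + a * c * (1 - b) + b * c * (1 - a) := by linarith
    have s3 : 0 ≤ a * b * (1 - c) * (A * C * (1 - B) + B * C * (1 - A)) + a * c * (1 - b) * (A * B * (1 - C) + B * C * (1 - A))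
        + b * c * (1 - a) * (A * B * (1 - C) + A * C * (1 - B)) :=
      add_nonneg (add_nonneg (mul_nonneg hx1 (add_nonneg hy2 hy3)) (mul_nonneg hx2 (add_nonneg hy1 hy3))) (mul_nonneg hx3 (add_nonneg hy1 hy2))
    exact add_nonneg (add_nonneg (mul_nonneg hxt s1) (mul_nonneg hyt s2)) s3
  have hQz : 0 ≤ qz := by rw [hqz]; exact hzq'
  have hZ1 : 0 ≤ z₁ := by rw [hz₁]; exact mul_nonneg (mul_nonneg hma hmb) hmc'
  have hZ2 : 0 ≤ z₂ := by rw [hz₂]; exact mul_nonneg (mul_nonneg hma hmc) hmb'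
  have hZ3 : 0 ≤ z₃ := by rw [hz₃]; exact mul_nonneg (mul_nonneg hmb hmc) hma'
  have hTz : 0 ≤ tz := by rw [htz]; exact mul_nonneg (mul_nonneg hma hmb) hmc
  refine ⟨?_, ?_, ?_, ?_, ?_, ?_⟩
  · rw [hq]; exact add_nonneg (mul_nonneg hp' hQw) (mul_nonneg hp₀ hQz)
  · rw [hu₁]; exact add_nonneg (mul_nonneg hp' hW1) (mul_nonneg hp₀ hZ1)
  · rw [hu₂]; exact add_nonneg (mul_nonneg hp' hW2) (mul_nonneg hp₀ hZ2)
  · rw [hu₃]; exact add_nonneg (mul_nonneg hp' hW3) (mul_nonneg hp₀ hZ3)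
  · rw [ht]; exact add_nonneg (mul_nonneg hp' hTw) (mul_nonneg hp₀ hTz)
  · rw [hq, hu₁, hu₂, hu₃, ht, hqw, hw₁, hw₂, hw₃, htw, hqz, hz₁, hz₂, hz₃, htz]; ring

/-- **HUB-EDGE THEOREM (sharp cubic row on `K_{2,3} +` hub edge).**  For arms and hub edge in `[0,1]`, the law `L_p` satisfies `AG ≥ 0` and
`max(Ha, Hb) ≥ 0` (`Hmax3 = max(q,t)·AG − e₃ ≥ 0`): the dichotomy `P(abc)² ≥ P(ab)P(ac)P(bc) ∨ P(a|b|c)² ≥ ∏ᵢ P(i ∤ rest)` holds on the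
smallest non-series–parallel three-terminal graph, for all weights. [folklore] -/
theorem hubEdge_sharp {p a b c A B C qw w₁ w₂ w₃ tw qz z₁ z₂ z₃ tz q u₁ u₂ u₃ t : ℝ}
    (hp₀ : 0 ≤ p) (hp₁ : p ≤ 1) (ha₀ : 0 ≤ a) (ha₁ : a ≤ 1) (hb₀ : 0 ≤ b) (hb₁ : b ≤ 1) (hc₀ : 0 ≤ c) (hc₁ : c ≤ 1)
    (hA₀ : 0 ≤ A) (hA₁ : A ≤ 1) (hB₀ : 0 ≤ B) (hB₁ : B ≤ 1) (hC₀ : 0 ≤ C) (hC₁ : C ≤ 1)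
    (hqw : qw = (1 - (a * b + a * c + b * c) + 2 * (a * b * c)) * (1 - (A * B + A * C + B * C) + 2 * (A * B * C)))
    (hw₁ : w₁ = (1 - (a * b + a * c + b * c) + 2 * (a * b * c)) * (A * B * (1 - C)) + a * b * (1 - c) * (1 - (A * B + A * C + B * C) + 2 * (A * B * C))
        + a * b * (1 - c) * (A * B * (1 - C)))
    (hw₂ : w₂ = (1 - (a * b + a * c + b * c) + 2 * (a * b * c)) * (A * C * (1 - B)) + a * c * (1 - b) * (1 - (A * B + A * C + B * C) + 2 * (A * B * C))
        + a * c * (1 - b) * (A * C * (1 - B)))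
    (hw₃ : w₃ = (1 - (a * b + a * c + b * c) + 2 * (a * b * c)) * (B * C * (1 - A)) + b * c * (1 - a) * (1 - (A * B + A * C + B * C) + 2 * (A * B * C))
        + b * c * (1 - a) * (B * C * (1 - A)))
    (htw : tw = a * b * c * ((1 - (A * B + A * C + B * C) + 2 * (A * B * C)) + A * B * (1 - C) + A * C * (1 - B) + B * C * (1 - A) + A * B * C)
        + A * B * C * ((1 - (a * b + a * c + b * c) + 2 * (a * b * c)) + a * b * (1 - c) + a * c * (1 - b) + b * c * (1 - a))
       
        + (a * b * (1 - c) * (A * C * (1 - B) + B * C * (1 - A)) + a * c * (1 - b) * (A * B * (1 - C) + B * C * (1 - A))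
        + b * c * (1 - a) * (A * B * (1 - C) + A * C * (1 - B))))
    (hqz : qz = 1 - ((a + A - a * A) * (b + B - b * B) + (a + A - a * A) * (c + C - c * C) + (b + B - b * B) * (c + C - c * C)) + 2 * ((a + A - a * A) * (b
        + B - b * B) * (c + C - c * C)))
    (hz₁ : z₁ = (a + A - a * A) * (b + B - b * B) * (1 - (c + C - c * C)))
    (hz₂ : z₂ = (a + A - a * A) * (c + C - c * C) * (1 - (b + B - b * B)))
    (hz₃ : z₃ = (b + B - b * B) * (c + C - c * C) * (1 - (a + A - a * A)))
    (htz : tz = (a + A - a * A) * (b + B - b * B) * (c + C - c * C))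
    (hq : q = (1 - p) * qw + p * qz) (hu₁ : u₁ = (1 - p) * w₁ + p * z₁) (hu₂ : u₂ = (1 - p) * w₂ + p * z₂)
    (hu₃ : u₃ = (1 - p) * w₃ + p * z₃) (ht : t = (1 - p) * tw + p * tz) :
    0 ≤ AG q u₁ u₂ u₃ t ∧ 0 ≤ max (Ha q u₁ u₂ u₃ t) (Hb q u₁ u₂ u₃ t) := by
  refine ⟨hubEdge_AG_nonneg hp₀ hp₁ ha₀ ha₁ hb₀ hb₁ hc₀ hc₁ hA₀ hA₁ hB₀ hB₁ hC₀ hC₁ hqw hw₁ hw₂ hw₃ htw hqz hz₁ hz₂ hz₃ htz hq hu₁ hu₂ hu₃ ht, ?_⟩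
  rcases le_total q t with hqt | htq
  · exact le_max_of_le_left (hubEdge_Ha_nonneg hp₀ hp₁ ha₀ ha₁ hb₀ hb₁ hc₀ hc₁ hA₀ hA₁ hB₀ hB₁ hC₀ hC₁ hqw hw₁ hw₂ hw₃ htw hqz hz₁ hz₂ hz₃ htz hq hu₁ hu₂ hu₃ ht hqt)
  · exact le_max_of_le_right (hubEdge_Hb_nonneg hp₀ hp₁ ha₀ ha₁ hb₀ hb₁ hc₀ hc₁ hA₀ hA₁ hB₀ hB₁ hC₀ hC₁ hqw hw₁ hw₂ hw₃ htw hqz hz₁ hz₂ hz₃ htz hq hu₁ hu₂ hu₃ ht htq)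

end CubicThreePointHub

end Summit.CriticalPhenomena.PercolationContinuityZ3.Theorems
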